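import Literature.AlgebraicGeometry.HodgeTheory.BirationalMorphismDegree
import Literature.AlgebraicGeometry.HodgeTheory.ComplexGysinHodgeTypeModels
import Literature.AlgebraicGeometry.HodgeTheory.HodgeStructureOfHodgeModel
import HarnessLib

/-!
# Coniveau descends along morphisms of non-zero degree; sub-Hodge conditions ascend along pull-backs

Family `hodge`, layer `Literature/AlgebraicGeometry/HodgeTheory` (theorems only; no definition, no
named fact). Requested by the line `registered` of the crux `LevelOneConiveauThreefolds`
(route `HodgeConjecture/SecondaryPeriods`, GHC(3,1) for smooth projective threefolds): the two
halves of "the generalised Hodge conjecture in coniveau `r` for `X'` implies it for `X` whenever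
`X' → X` has non-zero degree" (finite base changes, generically finite covers with a degree,
birational models).

* `mem_supportedClasses_of_map_mem_of_hasDegree` — **coniveau descends.** For `g : X' ⟶ X` of
  degree `d ≠ 0` (`HasDegree μ ν g(ℂ) d`) between smooth projective `n`-folds and
  `x ∈ Hᵏ(X(ℂ); ℂ)`: if `g^* x ∈ Nʳ Hᵏ(X'(ℂ))` then `x ∈ Nʳ Hᵏ(X(ℂ))`, because
  `g_!(g^* x) = d • x` (projection formula, Fulton, *Young Tableaux*, App. B (5)–(7); the tree's
  `gysinMap_map_of_hasDegree` with Poincaré duality `poincare_duality`) and `g_!` maps `Nʳ` into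
  `Nʳ` (Voisin II Prop. 9.21 (ii) on the coniveau carrier, the tree's
  `gysinMap_mem_supportedClasses_of_isSmoothProjective`). The `= ⊤` form is the tree's
  `supportedClasses_eq_top_of_hasDegree`; the algebraic-classes form is
  `mem_algebraicClasses_of_map_mem_of_hasDegree`. Birational case:
  `mem_supportedClasses_of_map_mem_of_isBirational` (degree one,
  `exists_hasDegree_one_of_isBirational`).
* `HodgeModel.map_map_pullback_le_iSup_hodgePQ_induce`,
  `HodgeModel.map_map_pullback_eq_iSup_inf_hodgePQ_induce` — **sub-Hodge conditions ascend.** For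
  `f : Y ⟶ X` (`dim Y = m ≤ n = dim X`), a Hodge model `A` of `X`, a Hodge model `B` of `Y` and a
  subspace `W ≤ Hᵏ(X(ℂ); ℂ)`: if `W|_{X^an}` lies in `⊕_{p+q=k, a ≤ p, b ≤ q} H^{p,q}_A` then
  `(f^* W)|_{Y^an}` lies in `⊕_{p+q=k, a ≤ p, b ≤ q} H^{p,q}` of the INDUCED model `B.induce A hmn`
  (Voisin I §7.3.2: `f^*` is a morphism of Hodge structures; model form
  `HodgeModel.pullback_map_mem_induce_hodgePQ`, no rigidity of de Rham comparisons needed), and if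
  `W|_{X^an} = ⊕_{p+q=k} (W|_{X^an} ∩ H^{p,q}_A)` (sub-Hodge structure) then the same holds for
  `f^* W` in the induced model. The transport is the linear map
  `T = (·)|_{Y^an} ∘ f^* ∘ ((·)|_{X^an})⁻¹ : Hᵏ(X^an) → Hᵏ(Y^an)`, which maps `H^{p,q}_A` into
  `H^{p,q}_{B.induce A}`.

## References

* [FultonYoungTableaux1997] W. Fulton, Young Tableaux, CUP 1997, Appendix B §B.1 (5)–(7).
* [VoisinHodgeII2003] C. Voisin, Hodge Theory and Complex Algebraic Geometry II, CUP 2003, §9.2.4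
  Prop. 9.21 (ii).
* [VoisinHodgeI2002] C. Voisin, Hodge Theory and Complex Algebraic Geometry I, CUP 2002, §7.3.2
  (pull-back and Gysin morphisms are morphisms of Hodge structures), Lemma 7.28.
* [GrothendieckTopology1969] A. Grothendieck, Hodge's general conjecture is false for trivial
  reasons, Topology 8 (1969), §1 (the filtration by coniveau).
-/

noncomputable section

open CategoryTheory AlgebraicGeometry
open Literature.AlgebraicTopology.SingularHomology

namespace Literature.AlgebraicGeometry.HodgeTheory

section HodgeTheory

/-! ### Coniveau descends along morphisms of non-zero degree -/

section Degree

variable {n : ℕ} {X' X : Motives.SchemeOver ℂ}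

/-- **Coniveau descends along a morphism of non-zero degree.** Let `g : X' ⟶ X` be a
`ℂ`-morphism of smooth projective varieties of the same dimension `n` whose continuous map
`g(ℂ)` has degree `d ≠ 0` for orientations `μ` of `X'(ℂ)` and `ν` of `X(ℂ)`
(`g(ℂ)_*[X'(ℂ)] = d • [X(ℂ)]`). If `g^* x` is supported in codimension `≥ r` on `X'`, then `x` is
supported in codimension `≥ r` on `X`: `g_!(g^* x) = d • x` (projection formula) and the Gysin
homomorphism maps `Nʳ Hᵏ(X'(ℂ))` into `Nʳ Hᵏ(X(ℂ))`.
[cite: FultonYoungTableaux1997, Appendix B §B.1 (5)–(7)] [cite: VoisinHodgeII2003, §9.2.4 Prop. 9.21 (ii)] -/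
theorem mem_supportedClasses_of_map_mem_of_hasDegree (hX' : Motives.IsSmoothProjective n X')
    (hX : Motives.IsSmoothProjective n X) (g : X' ⟶ X)
    (μ : HomologicalOrientation ℂ (Motives.ComplexPoints X') (2 * n))
    (ν : HomologicalOrientation ℂ (Motives.ComplexPoints X) (2 * n)) {d : ℤ} (hd : d ≠ 0)
    (hg : HasDegree μ ν (Motives.AlgPoints.mapContinuous (L := ℂ) g) d) {k r : ℕ}
    {x : complexBetti X k} (hx : complexBetti.map g k x ∈ supportedClasses X' k r) :
    x ∈ supportedClasses X k r := by
  by_cases hk : k ≤ 2 * n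
  · -- Poincaré duality for `X(ℂ)` (Hatcher Thm. 3.30, proved in the tree)
    have hν : ν.HasPoincareDuality := fun _ _ h' ↦
      Motives.ComplexPoints.bijective_poincareDualityMap_of (fun ν' _ _ h'' ↦ poincare_duality ν' h'')
        hX ν h'
    have hq : k + (2 * n - k) = 2 * n := by omega
    have hx' : singularCohomology.map ℂ ℂ (Motives.AlgPoints.mapContinuous (L := ℂ) g) k x ∈
        supportedClasses X' k r := hx
    have hgx := gysinMap_mem_supportedClasses_of_isSmoothProjective hX' hX μ ν hν g hq hq
      (add_comm r n).le hx'
    rw [gysinMap_map_of_hasDegree hν hg hq x, ← Int.cast_smul_eq_zsmul ℂ d x] at hgx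
    exact ((supportedClasses X k r).smul_mem_iff (Int.cast_ne_zero.2 hd)).1 hgx
  · haveI := subsingleton_complexBetti hX (k := k) (by omega)
    rw [Subsingleton.elim x 0]
    exact Submodule.zero_mem _

/-- Submodule form: `Nʳ Hᵏ(X'(ℂ))` pulled back along `g^*` lies in `Nʳ Hᵏ(X(ℂ))` for `g` of
non-zero degree. [cite: FultonYoungTableaux1997, Appendix B §B.1 (5)–(7)] -/
theorem comap_supportedClasses_le_of_hasDegree (hX' : Motives.IsSmoothProjective n X')
    (hX : Motives.IsSmoothProjective n X) (g : X' ⟶ X)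
    (μ : HomologicalOrientation ℂ (Motives.ComplexPoints X') (2 * n))
    (ν : HomologicalOrientation ℂ (Motives.ComplexPoints X) (2 * n)) {d : ℤ} (hd : d ≠ 0)
    (hg : HasDegree μ ν (Motives.AlgPoints.mapContinuous (L := ℂ) g) d) (k r : ℕ) :
    (supportedClasses X' k r).comap (complexBetti.map g k).hom ≤ supportedClasses X k r :=
  fun _ hx ↦ mem_supportedClasses_of_map_mem_of_hasDegree hX' hX g μ ν hd hg hx

/-- **Coniveau descends along birational morphisms** (e.g. from a blow-up to its base): a
birational `σ : X' ⟶ X` of smooth projective `n`-folds has degree one for suitable orientations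
(`exists_hasDegree_one_of_isBirational`, Fulton Lemma 19.1.2), so `σ^* x ∈ Nʳ Hᵏ(X'(ℂ))` implies
`x ∈ Nʳ Hᵏ(X(ℂ))`. [cite: FultonYoungTableaux1997, Appendix B §B.1 (5)–(7)]
[cite: Fulton1998, Lemma 19.1.2] -/
theorem mem_supportedClasses_of_map_mem_of_isBirational (hX' : Motives.IsSmoothProjective n X')
    (hX : Motives.IsSmoothProjective n X) (σ : X' ⟶ X) (hσ : Resolution.IsBirational σ.left)
    {k r : ℕ} {x : complexBetti X k} (hx : complexBetti.map σ k x ∈ supportedClasses X' k r) :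
    x ∈ supportedClasses X k r := by
  obtain ⟨μ, ν, h1⟩ := exists_hasDegree_one_of_isBirational hX' hX σ hσ
  exact mem_supportedClasses_of_map_mem_of_hasDegree hX' hX σ μ ν one_ne_zero h1 hx

end Degree

/-! ### Sub-Hodge conditions ascend along pull-backs (induced Hodge model) -/

section Pullback

variable {m n : ℕ} {Y X : Motives.SchemeOver ℂ}

/-- **Pull-back maps `H^{p,q}` of a model of `X` into `H^{p,q}` of the induced model of `Y`,
submodule form.** With `T = (·)|_{Y^an} ∘ f^* ∘ ((·)|_{X^an})⁻¹ : Hᵏ(X^an; ℂ) → Hᵏ(Y^an; ℂ)`,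
`T(H^{p,q}_A) ⊆ H^{p,q}_{B.induce A}` (Voisin I §7.3.2; pointwise form
`HodgeModel.pullback_map_mem_induce_hodgePQ`). [cite: VoisinHodgeI2002, §7.3.2] -/
theorem HodgeModel.map_hodgePQ_transport_le_induce (hY : Motives.IsSmoothProjective m Y)
    (hX : Motives.IsSmoothProjective n X) (B : HodgeModel m Y) (A : HodgeModel n X) (hmn : m ≤ n)
    (f : Y ⟶ X) (k p q : ℕ) :
    (A.hodgePQ k p q).map
        ((B.pullback k).hom ∘ₗ (complexBetti.map f k).hom ∘ₗ (A.pullbackEquiv k).symm.toLinearMap) ≤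
      (B.induce A hmn).hodgePQ k p q := by
  rintro _ ⟨y, hy, rfl⟩
  have hc : A.pullback k ((A.pullbackEquiv k).symm y) ∈ A.hodgePQ k p q := by
    rwa [← HodgeModel.pullbackEquiv_apply, LinearEquiv.apply_symm_apply]
  exact HodgeModel.pullback_map_mem_induce_hodgePQ hY hX B A hmn f hc

/-- The transport identity: `T ∘ (·)|_{X^an} = (·)|_{Y^an} ∘ f^*` on `Hᵏ(X(ℂ); ℂ)`, hence
`(f^* W)|_{Y^an} = T(W|_{X^an})` for every subspace `W`. [folklore] -/
theorem HodgeModel.map_map_pullback_eq_map_transport (B : HodgeModel m Y) (A : HodgeModel n X)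
    (f : Y ⟶ X) (k : ℕ) (W : Submodule ℂ (complexBetti X k)) :
    (W.map (complexBetti.map f k).hom).map (B.pullback k).hom =
      (W.map (A.pullback k).hom).map
        ((B.pullback k).hom ∘ₗ (complexBetti.map f k).hom ∘ₗ (A.pullbackEquiv k).symm.toLinearMap) := by
  rw [← Submodule.map_comp, ← Submodule.map_comp]
  congr 1
  refine LinearMap.ext fun w ↦ ?_
  simp only [LinearMap.coe_comp, LinearEquiv.coe_coe, Function.comp_apply]
  exact congrArg (fun v ↦ (B.pullback k).hom ((complexBetti.map f k).hom v))
    ((A.pullbackEquiv k).symm_apply_apply w).symm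

/-- **Hodge-level conditions ascend along pull-backs.** If `W|_{X^an} ⊆ ⊕_{p+q=k, a≤p, b≤q} H^{p,q}_A`
(e.g. `a = b = 1`, `k = 3`: `W` has Hodge coniveau `≥ 1`), then
`(f^* W)|_{Y^an} ⊆ ⊕_{p+q=k, a≤p, b≤q} H^{p,q}_{B.induce A}`. [cite: VoisinHodgeI2002, §7.3.2] -/
theorem HodgeModel.map_map_pullback_le_iSup_hodgePQ_induce (hY : Motives.IsSmoothProjective m Y)
    (hX : Motives.IsSmoothProjective n X) (B : HodgeModel m Y) (A : HodgeModel n X) (hmn : m ≤ n)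
    (f : Y ⟶ X) {k a b : ℕ} {W : Submodule ℂ (complexBetti X k)}
    (hW : W.map (A.pullback k).hom ≤
      ⨆ (p : ℕ) (q : ℕ) (_ : p + q = k) (_ : a ≤ p) (_ : b ≤ q), A.hodgePQ k p q) :
    (W.map (complexBetti.map f k).hom).map ((B.induce A hmn).pullback k).hom ≤
      ⨆ (p : ℕ) (q : ℕ) (_ : p + q = k) (_ : a ≤ p) (_ : b ≤ q), (B.induce A hmn).hodgePQ k p q := by
  rw [HodgeModel.induce_pullback, HodgeModel.map_map_pullback_eq_map_transport B A f k W]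
  refine (Submodule.map_mono hW).trans ?_
  simp only [Submodule.map_iSup]
  gcongr with p q _ _ _
  exact HodgeModel.map_hodgePQ_transport_le_induce hY hX B A hmn f k p q

/-- **Sub-Hodge structures ascend along pull-backs.** If `W|_{X^an} = ⊕_{p+q=k} (W|_{X^an} ∩ H^{p,q}_A)`
(the rational span `W` is a sub-Hodge structure, read in the model `A`), then
`(f^* W)|_{Y^an} = ⊕_{p+q=k} ((f^* W)|_{Y^an} ∩ H^{p,q}_{B.induce A})`.
[cite: VoisinHodgeI2002, §7.3.2] -/
theorem HodgeModel.map_map_pullback_eq_iSup_inf_hodgePQ_induce (hY : Motives.IsSmoothProjective m Y)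
    (hX : Motives.IsSmoothProjective n X) (B : HodgeModel m Y) (A : HodgeModel n X) (hmn : m ≤ n)
    (f : Y ⟶ X) {k : ℕ} {W : Submodule ℂ (complexBetti X k)}
    (hW : W.map (A.pullback k).hom =
      ⨆ (p : ℕ) (q : ℕ) (_ : p + q = k), W.map (A.pullback k).hom ⊓ A.hodgePQ k p q) :
    (W.map (complexBetti.map f k).hom).map ((B.induce A hmn).pullback k).hom =
      ⨆ (p : ℕ) (q : ℕ) (_ : p + q = k),
        (W.map (complexBetti.map f k).hom).map ((B.induce A hmn).pullback k).hom ⊓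
          (B.induce A hmn).hodgePQ k p q := by
  refine le_antisymm ?_ (iSup_le fun p ↦ iSup_le fun q ↦ iSup_le fun _ ↦ inf_le_left)
  rw [HodgeModel.induce_pullback, HodgeModel.map_map_pullback_eq_map_transport B A f k W]
  conv_lhs => rw [hW]
  simp only [Submodule.map_iSup]
  gcongr with p q _
  exact le_inf (Submodule.map_mono inf_le_left)
    ((Submodule.map_mono inf_le_right).trans
      (HodgeModel.map_hodgePQ_transport_le_induce hY hX B A hmn f k p q))

end Pullback

end HodgeTheory

end Literature.AlgebraicGeometry.HodgeTheory

end
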